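import Mathlib
import HarnessLib

/-!
# N1-mono ▸ piece (d8): THE RETURN MAP of the deep-belt monodromy — normalisation of the lift
(wave 8, brick of stub `stub_M2geo` = node N1 ▸ `piece_d` = `helper_N1_beltMonodromy`, line
`modp-braid-orbits`, crux `ConvexBisection.AcyclicBisectionExists`, item stmt-SmoothPoincare4-10508;
worker J3, lead c5; registered sub-goal `helper_beltReturnMap`)

Setting (H4-REPORT §4 (d7)(d8), `work/stubs/H4H7_interface.lean`): the glued belt chart
`Λ : ℝ × ℝ × ℝ → ∂X₀` of piece (d7) and the plain seam-lift chart `Λ₀` (H4-8) are two `1`-periodic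
families of level-wise injective charts; ABOVE the core zone (`η/2 ≤ σ < η`) the flow of (d7) keeps the
chart coordinates, so `Λ (u, r, σ) = Λ₀ (G₁ (u, r), σ)` for ONE smooth `σ`-independent coordinate map
`G₁` on the open strip `ℝ × (−1, 1)`, and on the SIDES (`|r| ≥ 1/2`) `Λ = Λ₀`.  This file proves the
purely topological normalisation (d8): from these RAW clauses alone,

* `G₁ (u + 1, r) = G₁ (u, r) + (1, 0)` automatically (the defect is a continuous integer-valued
  function on a connected strip, equal to `1` on the lower side strip where `G₁ ≡ id (mod ℤ × 0)`);
* after subtracting the integer `c₋` by which `G₁` shifts the lower side strip, the map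
  `G := G₁ − (c₋, 0)` is the identity on `−1 < r ≤ −1/2` and the translation `(u + n₀, r)` on
  `1/2 ≤ r < 1` for ONE INTEGER `n₀` (the total displacement of the return map; piece (d9) identifies
  `n₀ = ±1`), extends affinely to a smooth map of all of `ℝ²`, and still factors `Λ` through `Λ₀` above
  (integer shifts are invisible to the `1`-periodic `Λ₀`).

Main result `helper_beltReturnMap` (generic in the target type of the charts: no geometry is used).
Reference: R. E. Gompf, A. I. Stipsicz, *4-Manifolds and Kirby Calculus* (1999), §8.2 (the monodromy
around a Lefschetz critical value as a self-map of the annulus) [GompfStipsicz1999].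
-/

noncomputable section

set_option linter.dupNamespace false

open scoped Manifold ContDiff Topology
open Set Function

namespace Summit.SmoothPoincare4.SmoothPoincare4.Theorems.AcyclicBisectionExists.ModpBraidOrbits

namespace BeltReturn

/-! ## §1 Integer-valued continuous functions on connected sets -/

/-- Half an integer is not an integer. [folklore] -/
theorem int_add_half_ne_int (m j : ℤ) : (m : ℝ) + 1 / 2 ≠ (j : ℝ) := by
  intro h
  have h2 : ((2 * (j - m) : ℤ) : ℝ) = ((1 : ℤ) : ℝ) := by push_cast; linarith
  have h3 : 2 * (j - m) = 1 := by exact_mod_cast h2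
  omega

/-- A continuous real function with integer values on a preconnected set is constant there.
[folklore] -/
theorem eq_of_intValued {X : Type*} [TopologicalSpace X] {S : Set X} (hS : IsPreconnected S)
    {f : X → ℝ} (hf : ContinuousOn f S) (hval : ∀ p ∈ S, ∃ m : ℤ, f p = m) {x y : X}
    (hx : x ∈ S) (hy : y ∈ S) : f x = f y := by
  obtain ⟨m, hm⟩ := hval x hx
  obtain ⟨m', hm'⟩ := hval y hy
  have himg : IsPreconnected (f '' S) := hS.image f hf
  by_contra hne
  rw [hm, hm'] at hne
  have hne' : m ≠ m' := fun h => hne (by rw [h])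
  rcases lt_or_gt_of_ne hne' with hlt | hlt
  · have hsub := himg.Icc_subset (mem_image_of_mem f hx) (mem_image_of_mem f hy)
    rw [hm, hm'] at hsub
    have hmid : (m : ℝ) + 1 / 2 ∈ Icc (m : ℝ) m' := by
      have : (m : ℝ) + 1 ≤ m' := by exact_mod_cast hlt
      constructor <;> linarith
    obtain ⟨z, hz, hfz⟩ := hsub hmid
    obtain ⟨j, hj⟩ := hval z hz
    exact int_add_half_ne_int m j (by rw [← hfz, hj])
  · have hsub := himg.Icc_subset (mem_image_of_mem f hy) (mem_image_of_mem f hx)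
    rw [hm, hm'] at hsub
    have hmid : (m' : ℝ) + 1 / 2 ∈ Icc (m' : ℝ) m := by
      have : (m' : ℝ) + 1 ≤ m := by exact_mod_cast hlt
      constructor <;> linarith
    obtain ⟨z, hz, hfz⟩ := hsub hmid
    obtain ⟨j, hj⟩ := hval z hz
    exact int_add_half_ne_int m' j (by rw [← hfz, hj])

/-! ## §2 Periodic charts: integer shifts and injectivity modulo `ℤ` -/

/-- A `1`-periodic family is invariant under all integer shifts. [folklore] -/
theorem periodic_int_shift {α : Type*} {Λ₀ : ℝ × ℝ × ℝ → α}
    (hper : ∀ u r σ, Λ₀ (u + 1, r, σ) = Λ₀ (u, r, σ)) (m : ℤ) (u r σ : ℝ) :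
    Λ₀ (u + m, r, σ) = Λ₀ (u, r, σ) := by
  have hnat : ∀ (n : ℕ) (u : ℝ), Λ₀ (u + n, r, σ) = Λ₀ (u, r, σ) := by
    intro n
    induction n with
    | zero => intro u; simp
    | succ n ih =>
      intro u
      have : u + ((n + 1 : ℕ) : ℝ) = (u + n) + 1 := by push_cast; ring
      rw [this, hper, ih]
  obtain ⟨n, rfl | rfl⟩ := Int.eq_nat_or_neg m
  · exact_mod_cast hnat n u
  · have h := hnat n (u + ((-(n : ℤ) : ℤ) : ℝ))
    rw [show u + ((-(n : ℤ) : ℤ) : ℝ) + (n : ℝ) = u by push_cast; ring] at h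
    exact h.symm

/-- Two points of the open strip with the same image under a `1`-periodic chart that is injective on
the fundamental domain `[0,1) × (−1,1)` have equal heights and abscissae differing by an integer.
[folklore] -/
theorem eq_mod_int_of_periodic_injOn {α : Type*} {Λ₀ : ℝ × ℝ × ℝ → α} {σ : ℝ}
    (hper : ∀ u r σ, Λ₀ (u + 1, r, σ) = Λ₀ (u, r, σ))
    (hinj : InjOn (fun p : ℝ × ℝ => Λ₀ (p.1, p.2, σ)) (Ico (0 : ℝ) 1 ×ˢ Ioo (-1 : ℝ) 1))
    {p q : ℝ × ℝ} (hp : p.2 ∈ Ioo (-1 : ℝ) 1) (hq : q.2 ∈ Ioo (-1 : ℝ) 1)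
    (heq : Λ₀ (p.1, p.2, σ) = Λ₀ (q.1, q.2, σ)) :
    p.2 = q.2 ∧ ∃ m : ℤ, p.1 - q.1 = m := by
  have hfp : Λ₀ (Int.fract p.1, p.2, σ) = Λ₀ (p.1, p.2, σ) := by
    have h := periodic_int_shift hper (-⌊p.1⌋) p.1 p.2 σ
    rw [show p.1 + ((-⌊p.1⌋ : ℤ) : ℝ) = Int.fract p.1 by rw [Int.fract]; push_cast; ring] at h
    exact h
  have hfq : Λ₀ (Int.fract q.1, q.2, σ) = Λ₀ (q.1, q.2, σ) := by
    have h := periodic_int_shift hper (-⌊q.1⌋) q.1 q.2 σ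
    rw [show q.1 + ((-⌊q.1⌋ : ℤ) : ℝ) = Int.fract q.1 by rw [Int.fract]; push_cast; ring] at h
    exact h
  have hmem : ∀ x : ℝ × ℝ, x.2 ∈ Ioo (-1 : ℝ) 1 →
      (Int.fract x.1, x.2) ∈ Ico (0 : ℝ) 1 ×ˢ Ioo (-1 : ℝ) 1 :=
    fun x hx => ⟨⟨Int.fract_nonneg _, Int.fract_lt_one _⟩, hx⟩
  have h := hinj (hmem p hp) (hmem q hq) (by simp only; rw [hfp, hfq, heq])
  simp only [Prod.mk.injEq] at h
  refine ⟨h.2, ⌊p.1⌋ - ⌊q.1⌋, ?_⟩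
  have ep := Int.floor_add_fract p.1
  have eq' := Int.floor_add_fract q.1
  push_cast
  linarith [h.1]


/-! ## §3 The equivariance defect and the side shifts of the raw coordinate map -/

section Raw

variable {α : Type*} {Λ Λ₀ : ℝ × ℝ × ℝ → α} {η : ℝ} {G₁ : ℝ × ℝ → ℝ × ℝ}

/-- On a side strip where `Λ = Λ₀`, the raw coordinate map is the identity modulo `ℤ × 0`:
`(G₁ (u, r)).2 = r` and `(G₁ (u, r)).1 − u ∈ ℤ`. [folklore] -/
theorem raw_side_modZ
    (hper : ∀ u r σ, Λ₀ (u + 1, r, σ) = Λ₀ (u, r, σ))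
    (hinj : InjOn (fun p : ℝ × ℝ => Λ₀ (p.1, p.2, η / 2)) (Ico (0 : ℝ) 1 ×ˢ Ioo (-1 : ℝ) 1))
    (hG₁r : ∀ u r, r ∈ Ioo (-1 : ℝ) 1 → (G₁ (u, r)).2 ∈ Ioo (-1 : ℝ) 1)
    (habove : ∀ u r, r ∈ Ioo (-1 : ℝ) 1 →
      Λ (u, r, η / 2) = Λ₀ ((G₁ (u, r)).1, (G₁ (u, r)).2, η / 2))
    (hsides : ∀ u r, r ∈ Ioo (-1 : ℝ) 1 → 1 / 2 ≤ |r| → Λ (u, r, η / 2) = Λ₀ (u, r, η / 2))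
    {u r : ℝ} (hr : r ∈ Ioo (-1 : ℝ) 1) (hside : 1 / 2 ≤ |r|) :
    (G₁ (u, r)).2 = r ∧ ∃ m : ℤ, (G₁ (u, r)).1 - u = m := by
  have heq : Λ₀ ((G₁ (u, r)).1, (G₁ (u, r)).2, η / 2) = Λ₀ (u, r, η / 2) := by
    rw [← habove u r hr, hsides u r hr hside]
  exact eq_mod_int_of_periodic_injOn (p := G₁ (u, r)) (q := (u, r)) hper hinj (hG₁r u r hr) hr heq

/-- The equivariance defect of the raw coordinate map is an integer shift of the abscissa:
`(G₁ (u+1, r)).2 = (G₁ (u, r)).2` and `(G₁ (u+1, r)).1 − (G₁ (u, r)).1 ∈ ℤ`. [folklore] -/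
theorem raw_defect_modZ
    (hper : ∀ u r σ, Λ₀ (u + 1, r, σ) = Λ₀ (u, r, σ))
    (hΛper : ∀ u r σ, Λ (u + 1, r, σ) = Λ (u, r, σ))
    (hinj : InjOn (fun p : ℝ × ℝ => Λ₀ (p.1, p.2, η / 2)) (Ico (0 : ℝ) 1 ×ˢ Ioo (-1 : ℝ) 1))
    (hG₁r : ∀ u r, r ∈ Ioo (-1 : ℝ) 1 → (G₁ (u, r)).2 ∈ Ioo (-1 : ℝ) 1)
    (habove : ∀ u r, r ∈ Ioo (-1 : ℝ) 1 →
      Λ (u, r, η / 2) = Λ₀ ((G₁ (u, r)).1, (G₁ (u, r)).2, η / 2))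
    {u r : ℝ} (hr : r ∈ Ioo (-1 : ℝ) 1) :
    (G₁ (u + 1, r)).2 = (G₁ (u, r)).2 ∧ ∃ m : ℤ, (G₁ (u + 1, r)).1 - (G₁ (u, r)).1 = m := by
  have heq : Λ₀ ((G₁ (u + 1, r)).1, (G₁ (u + 1, r)).2, η / 2) =
      Λ₀ ((G₁ (u, r)).1, (G₁ (u, r)).2, η / 2) := by
    rw [← habove (u + 1) r hr, ← habove u r hr, hΛper]
  exact eq_mod_int_of_periodic_injOn (p := G₁ (u + 1, r)) (q := G₁ (u, r)) hper hinj
    (hG₁r (u + 1) r hr) (hG₁r u r hr) heq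

/-- Continuity of the coordinates of the raw map on sub-strips of the open strip. [folklore] -/
theorem raw_continuousOn (hG₁ : ContDiffOn ℝ ∞ G₁ (univ ×ˢ Ioo (-1 : ℝ) 1)) {S : Set ℝ}
    (hS : S ⊆ Ioo (-1 : ℝ) 1) (a : ℝ) :
    ContinuousOn (fun p : ℝ × ℝ => (G₁ (p.1 + a, p.2)).1 - (G₁ p).1) (univ ×ˢ S) ∧
      ContinuousOn (fun p : ℝ × ℝ => (G₁ p).1 - p.1) (univ ×ˢ S) := by
  have hc : ContinuousOn G₁ (univ ×ˢ Ioo (-1 : ℝ) 1) := hG₁.continuousOn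
  have hsub : (univ : Set ℝ) ×ˢ S ⊆ (univ : Set ℝ) ×ˢ Ioo (-1 : ℝ) 1 := prod_mono subset_rfl hS
  have hshift : ContinuousOn (fun p : ℝ × ℝ => G₁ (p.1 + a, p.2)) (univ ×ˢ S) := by
    refine hc.comp (by fun_prop) ?_
    intro p hp
    exact ⟨mem_univ _, hS hp.2⟩
  refine ⟨?_, ?_⟩
  · exact (continuous_fst.comp_continuousOn hshift).sub
      (continuous_fst.comp_continuousOn (hc.mono hsub))
  · exact (continuous_fst.comp_continuousOn (hc.mono hsub)).sub continuous_fst.continuousOn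

/-- **The lower side shift**: one integer `c₋` with `G₁ (u, r) = (u + c₋, r)` on `−1 < r ≤ −1/2`.
[folklore] -/
theorem raw_lower_shift (hη : 0 < η)
    (hG₁ : ContDiffOn ℝ ∞ G₁ (univ ×ˢ Ioo (-1 : ℝ) 1))
    (hper : ∀ u r σ, Λ₀ (u + 1, r, σ) = Λ₀ (u, r, σ))
    (hinj : InjOn (fun p : ℝ × ℝ => Λ₀ (p.1, p.2, η / 2)) (Ico (0 : ℝ) 1 ×ˢ Ioo (-1 : ℝ) 1))
    (hG₁r : ∀ u r, r ∈ Ioo (-1 : ℝ) 1 → (G₁ (u, r)).2 ∈ Ioo (-1 : ℝ) 1)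
    (habove : ∀ u r σ, r ∈ Ioo (-1 : ℝ) 1 → η / 2 ≤ σ → σ < η →
      Λ (u, r, σ) = Λ₀ ((G₁ (u, r)).1, (G₁ (u, r)).2, σ))
    (hsides : ∀ u r σ, r ∈ Ioo (-1 : ℝ) 1 → 1 / 2 ≤ |r| → η / 2 ≤ σ → σ < η →
      Λ (u, r, σ) = Λ₀ (u, r, σ)) :
    ∃ c : ℤ, ∀ u r, r ∈ Ioc (-1 : ℝ) (-(1 / 2)) → G₁ (u, r) = (u + c, r) := by
  have hσ₁ : η / 2 ≤ η / 2 := le_rfl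
  have hσ₂ : η / 2 < η := by linarith
  have hS : Ioc (-1 : ℝ) (-(1 / 2)) ⊆ Ioo (-1 : ℝ) 1 := fun r hr => ⟨hr.1, by linarith [hr.2]⟩
  have habs : ∀ r ∈ Ioc (-1 : ℝ) (-(1 / 2)), 1 / 2 ≤ |r| := fun r hr => by
    rw [abs_of_neg (by linarith [hr.2])]; linarith [hr.2]
  have key : ∀ u r, r ∈ Ioc (-1 : ℝ) (-(1 / 2)) →
      (G₁ (u, r)).2 = r ∧ ∃ m : ℤ, (G₁ (u, r)).1 - u = m := fun u r hr =>
    raw_side_modZ hper hinj hG₁r (fun u r hr => habove u r _ hr hσ₁ hσ₂)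
      (fun u r hr hs => hsides u r _ hr hs hσ₁ hσ₂) (hS hr) (habs r hr)
  have h0 : (-(3 / 4) : ℝ) ∈ Ioc (-1 : ℝ) (-(1 / 2)) := by norm_num
  obtain ⟨c, hc⟩ := (key 0 (-(3 / 4)) h0).2
  refine ⟨c, fun u r hr => ?_⟩
  have hconst := eq_of_intValued (f := fun p : ℝ × ℝ => (G₁ p).1 - p.1)
    ((convex_univ.prod (convex_Ioc _ _)).isPreconnected) (raw_continuousOn hG₁ hS 0).2
    (fun p hp => (key p.1 p.2 hp.2).2) (x := (u, r)) (y := ((0 : ℝ), (-(3 / 4) : ℝ)))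
    ⟨mem_univ _, hr⟩ ⟨mem_univ _, h0⟩
  simp only at hconst
  rw [hc] at hconst
  refine Prod.ext ?_ (key u r hr).1
  simp only
  linarith

/-- **The upper side shift**: one integer `c₊` with `G₁ (u, r) = (u + c₊, r)` on `1/2 ≤ r < 1`.
[folklore] -/
theorem raw_upper_shift (hη : 0 < η)
    (hG₁ : ContDiffOn ℝ ∞ G₁ (univ ×ˢ Ioo (-1 : ℝ) 1))
    (hper : ∀ u r σ, Λ₀ (u + 1, r, σ) = Λ₀ (u, r, σ))
    (hinj : InjOn (fun p : ℝ × ℝ => Λ₀ (p.1, p.2, η / 2)) (Ico (0 : ℝ) 1 ×ˢ Ioo (-1 : ℝ) 1))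
    (hG₁r : ∀ u r, r ∈ Ioo (-1 : ℝ) 1 → (G₁ (u, r)).2 ∈ Ioo (-1 : ℝ) 1)
    (habove : ∀ u r σ, r ∈ Ioo (-1 : ℝ) 1 → η / 2 ≤ σ → σ < η →
      Λ (u, r, σ) = Λ₀ ((G₁ (u, r)).1, (G₁ (u, r)).2, σ))
    (hsides : ∀ u r σ, r ∈ Ioo (-1 : ℝ) 1 → 1 / 2 ≤ |r| → η / 2 ≤ σ → σ < η →
      Λ (u, r, σ) = Λ₀ (u, r, σ)) :
    ∃ c : ℤ, ∀ u r, r ∈ Ico (1 / 2 : ℝ) 1 → G₁ (u, r) = (u + c, r) := by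
  have hσ₁ : η / 2 ≤ η / 2 := le_rfl
  have hσ₂ : η / 2 < η := by linarith
  have hS : Ico (1 / 2 : ℝ) 1 ⊆ Ioo (-1 : ℝ) 1 := fun r hr => ⟨by linarith [hr.1], hr.2⟩
  have habs : ∀ r ∈ Ico (1 / 2 : ℝ) 1, 1 / 2 ≤ |r| := fun r hr => by
    rw [abs_of_pos (by linarith [hr.1])]; exact hr.1
  have key : ∀ u r, r ∈ Ico (1 / 2 : ℝ) 1 →
      (G₁ (u, r)).2 = r ∧ ∃ m : ℤ, (G₁ (u, r)).1 - u = m := fun u r hr =>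
    raw_side_modZ hper hinj hG₁r (fun u r hr => habove u r _ hr hσ₁ hσ₂)
      (fun u r hr hs => hsides u r _ hr hs hσ₁ hσ₂) (hS hr) (habs r hr)
  have h0 : ((3 / 4) : ℝ) ∈ Ico (1 / 2 : ℝ) 1 := by norm_num
  obtain ⟨c, hc⟩ := (key 0 (3 / 4) h0).2
  refine ⟨c, fun u r hr => ?_⟩
  have hconst := eq_of_intValued (f := fun p : ℝ × ℝ => (G₁ p).1 - p.1)
    ((convex_univ.prod (convex_Ico _ _)).isPreconnected) (raw_continuousOn hG₁ hS 0).2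
    (fun p hp => (key p.1 p.2 hp.2).2) (x := (u, r)) (y := ((0 : ℝ), ((3 / 4) : ℝ)))
    ⟨mem_univ _, hr⟩ ⟨mem_univ _, h0⟩
  simp only at hconst
  rw [hc] at hconst
  refine Prod.ext ?_ (key u r hr).1
  simp only
  linarith

/-- **Automatic equivariance** of the raw coordinate map on the open strip:
`G₁ (u + 1, r) = G₁ (u, r) + (1, 0)`. [folklore] -/
theorem raw_equivariant (hη : 0 < η)
    (hG₁ : ContDiffOn ℝ ∞ G₁ (univ ×ˢ Ioo (-1 : ℝ) 1))
    (hper : ∀ u r σ, Λ₀ (u + 1, r, σ) = Λ₀ (u, r, σ))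
    (hΛper : ∀ u r σ, Λ (u + 1, r, σ) = Λ (u, r, σ))
    (hinj : InjOn (fun p : ℝ × ℝ => Λ₀ (p.1, p.2, η / 2)) (Ico (0 : ℝ) 1 ×ˢ Ioo (-1 : ℝ) 1))
    (hG₁r : ∀ u r, r ∈ Ioo (-1 : ℝ) 1 → (G₁ (u, r)).2 ∈ Ioo (-1 : ℝ) 1)
    (habove : ∀ u r σ, r ∈ Ioo (-1 : ℝ) 1 → η / 2 ≤ σ → σ < η →
      Λ (u, r, σ) = Λ₀ ((G₁ (u, r)).1, (G₁ (u, r)).2, σ))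
    (hsides : ∀ u r σ, r ∈ Ioo (-1 : ℝ) 1 → 1 / 2 ≤ |r| → η / 2 ≤ σ → σ < η →
      Λ (u, r, σ) = Λ₀ (u, r, σ))
    (u r : ℝ) (hr : r ∈ Ioo (-1 : ℝ) 1) : G₁ (u + 1, r) = G₁ (u, r) + (1, 0) := by
  have hσ₁ : η / 2 ≤ η / 2 := le_rfl
  have hσ₂ : η / 2 < η := by linarith
  have key : ∀ u r, r ∈ Ioo (-1 : ℝ) 1 →
      (G₁ (u + 1, r)).2 = (G₁ (u, r)).2 ∧ ∃ m : ℤ, (G₁ (u + 1, r)).1 - (G₁ (u, r)).1 = m :=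
    fun u r hr => raw_defect_modZ hper hΛper hinj hG₁r (fun u r hr => habove u r _ hr hσ₁ hσ₂) hr
  obtain ⟨c, hc⟩ := raw_lower_shift hη hG₁ hper hinj hG₁r habove hsides
  have h0 : (-(3 / 4) : ℝ) ∈ Ioo (-1 : ℝ) 1 := by norm_num
  have h0' : (-(3 / 4) : ℝ) ∈ Ioc (-1 : ℝ) (-(1 / 2)) := by norm_num
  have hval0 : (G₁ ((0 : ℝ) + 1, -(3 / 4))).1 - (G₁ (0, -(3 / 4))).1 = 1 := by
    rw [hc _ _ h0', hc _ _ h0']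
    simp
  have hconst := eq_of_intValued (f := fun p : ℝ × ℝ => (G₁ (p.1 + 1, p.2)).1 - (G₁ p).1)
    ((convex_univ.prod (convex_Ioo _ _)).isPreconnected) (raw_continuousOn hG₁ subset_rfl 1).1
    (fun p hp => (key p.1 p.2 hp.2).2) (x := (u, r)) (y := ((0 : ℝ), (-(3 / 4) : ℝ)))
    ⟨mem_univ _, hr⟩ ⟨mem_univ _, h0⟩
  simp only at hconst
  rw [hval0] at hconst
  refine Prod.ext ?_ ?_
  · simp only [Prod.fst_add]; linarith
  · simp only [Prod.snd_add, add_zero]; exact (key u r hr).1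

end Raw

end BeltReturn

open BeltReturn in
/-- **Sub-goal `helper_beltReturnMap` — piece (d8) of N1-mono: THE RETURN MAP.**  Let `Λ, Λ₀` be two
`1`-periodic families of charts into any type `α` (in N1-mono: the glued belt chart of piece (d7) and
the plain seam-lift chart of H4-8, into `∂X₀`), `Λ₀` injective on the fundamental domain
`[0,1) × (−1,1)` at the level `η/2`, and let `G₁` be a smooth RAW coordinate map on the open strip
`ℝ × (−1,1)` (values in the strip) through which `Λ` factors ABOVE (`η/2 ≤ σ < η`:
`Λ (u,r,σ) = Λ₀ (G₁ (u,r), σ)`), with `Λ = Λ₀` on the SIDES `|r| ≥ 1/2`.  Then there are an INTEGER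
`n₀` and a smooth map `G : ℝ² → ℝ²` — the normalised lift of the return map — with
`G (u+1, r) = G (u,r) + (1,0)`, `G = id` on `r ≤ −1/2`, `G (u,r) = (u + n₀, r)` on `r ≥ 1/2`, second
coordinate in `(−1,1)` on the strip, `Λ (u,r,σ) = Λ₀ (G (u,r), σ)` above, and `G = G₁ − (m, 0)` on the
strip for one integer `m`.  (Piece (d9) identifies `n₀ = if s then 1 else −1`.)
[cite: GompfStipsicz1999, §8.2] -/
theorem helper_beltReturnMap : ∀ (α : Type) (Λ Λ₀ : ℝ × ℝ × ℝ → α) (η : ℝ) (G₁ : ℝ × ℝ → ℝ × ℝ), 0 < η → ContDiffOn ℝ ∞ G₁ (Set.univ ×ˢ Set.Ioo (-1 : ℝ) 1) → (∀ u r σ, Λ₀ (u + 1, r, σ) = Λ₀ (u, r, σ)) → (∀ u r σ, Λ (u + 1, r, σ) = Λ (u, r, σ)) → Set.InjOn (fun p : ℝ × ℝ => Λ₀ (p.1, p.2, η / 2)) (Set.Ico (0 : ℝ) 1 ×ˢ Set.Ioo (-1 : ℝ) 1) → (∀ u r, r ∈ Set.Ioo (-1 : ℝ) 1 → (G₁ (u,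 r)).2 ∈ Set.Ioo (-1 : ℝ) 1) → (∀ u r σ, r ∈ Set.Ioo (-1 : ℝ) 1 → η / 2 ≤ σ → σ < η → Λ (u, r, σ) = Λ₀ ((G₁ (u, r)).1, (G₁ (u, r)).2, σ)) → (∀ u r σ, r ∈ Set.Ioo (-1 : ℝ) 1 → 1 / 2 ≤ |r| → η / 2 ≤ σ → σ < η → Λ (u, r, σ) = Λ₀ (u, r, σ)) → ∃ (n₀ m : ℤ) (G : ℝ × ℝ → ℝ × ℝ), ContDiff ℝ ∞ G ∧ (∀ u r, G (u + 1, r) = G (u, r) + (1, 0)) ∧ (∀ u r, r ≤ -(1 / 2 : ℝ) → G (u, r) = (u, r)) ∧ (∀ u r, (1 / 2 : ℝ) ≤ r → G (u, r) = (u + n₀, r)) ∧ (∀ u r, r ∈ Set.Ioo (-1 : ℝ) 1 → (G (u, r)).2 ∈ Set.Ioo (-1 : ℝ) 1) ∧ (∀ u r σ, r ∈ Set.Ioo (-1 : ℝ) 1 → η / 2 ≤ σ → σ < η → Λ (u, r, σ) = Λ₀ ((G (u, r)).1, (G (u, r)).2, σ)) ∧ (∀ u r, r ∈ Set.Ioo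 (-1 : ℝ) 1 → G (u, r) = G₁ (u, r) - ((m : ℝ), (0 : ℝ))) := by
  intro α Λ Λ₀ η G₁ hη hG₁ hper hΛper hinj hG₁r habove hsides
  obtain ⟨cm, hcm⟩ := raw_lower_shift hη hG₁ hper hinj hG₁r habove hsides
  obtain ⟨cp, hcp⟩ := raw_upper_shift hη hG₁ hper hinj hG₁r habove hsides
  have heqv := raw_equivariant hη hG₁ hper hΛper hinj hG₁r habove hsides
  let G : ℝ × ℝ → ℝ × ℝ := fun p =>
    if p.2 ≤ -(1 / 2 : ℝ) then p else if (1 / 2 : ℝ) ≤ p.2 then (p.1 + ((cp - cm : ℤ) : ℝ), p.2)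
      else G₁ p - ((cm : ℝ), (0 : ℝ))
  have hGlow : ∀ p : ℝ × ℝ, p.2 ≤ -(1 / 2 : ℝ) → G p = p := fun p hp => by
    simp only [G, if_pos hp]
  have hGup : ∀ p : ℝ × ℝ, (1 / 2 : ℝ) ≤ p.2 → G p = (p.1 + ((cp - cm : ℤ) : ℝ), p.2) := fun p hp => by
    have h1 : ¬ p.2 ≤ -(1 / 2 : ℝ) := by linarith
    simp only [G, if_neg h1, if_pos hp]
  have hGmid : ∀ p : ℝ × ℝ, ¬ p.2 ≤ -(1 / 2 : ℝ) → ¬ (1 / 2 : ℝ) ≤ p.2 →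
      G p = G₁ p - ((cm : ℝ), (0 : ℝ)) := fun p h1 h2 => by
    simp only [G, if_neg h1, if_neg h2]
  -- on the whole open strip `G = G₁ − (c₋, 0)`
  have hGstrip : ∀ p : ℝ × ℝ, p.2 ∈ Ioo (-1 : ℝ) 1 → G p = G₁ p - ((cm : ℝ), (0 : ℝ)) := by
    rintro ⟨u, r⟩ hr
    by_cases h1 : r ≤ -(1 / 2 : ℝ)
    · rw [hGlow (u, r) h1, hcm u r ⟨hr.1, h1⟩]; ext <;> simp
    by_cases h2 : (1 / 2 : ℝ) ≤ r
    · rw [hGup (u, r) h2, hcp u r ⟨h2, hr.2⟩]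
      ext
      · simp; ring
      · simp
    · exact hGmid (u, r) h1 h2
  refine ⟨cp - cm, cm, G, ?_, ?_, fun u r hr => hGlow (u, r) hr, fun u r hr => hGup (u, r) hr,
    ?_, ?_, fun u r hr => hGstrip (u, r) hr⟩
  · -- smoothness: locally `G` is `G₁ − const`, `id`, or a translation
    refine contDiff_iff_contDiffAt.2 fun p => ?_
    by_cases hp : p.2 ∈ Ioo (-1 : ℝ) 1
    · have hopen : IsOpen ((univ : Set ℝ) ×ˢ Ioo (-1 : ℝ) 1) := isOpen_univ.prod isOpen_Ioo
      have hmem : p ∈ (univ : Set ℝ) ×ˢ Ioo (-1 : ℝ) 1 := ⟨mem_univ _, hp⟩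
      have h1 : ContDiffAt ℝ ∞ (fun q => G₁ q - ((cm : ℝ), (0 : ℝ))) p :=
        (hG₁.contDiffAt (hopen.mem_nhds hmem)).sub contDiffAt_const
      refine h1.congr_of_eventuallyEq (Filter.eventually_of_mem (hopen.mem_nhds hmem) ?_)
      intro q hq
      exact hGstrip q hq.2
    · rw [mem_Ioo, not_and_or, not_lt, not_lt] at hp
      rcases hp with hp | hp
      · have hopen : IsOpen {q : ℝ × ℝ | q.2 < -(1 / 2 : ℝ)} := isOpen_lt continuous_snd continuous_const
        have hmem : p ∈ {q : ℝ × ℝ | q.2 < -(1 / 2 : ℝ)} := by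
          show p.2 < -(1 / 2 : ℝ); linarith
        refine contDiffAt_id.congr_of_eventuallyEq (Filter.eventually_of_mem (hopen.mem_nhds hmem) ?_)
        intro q hq
        exact hGlow q (le_of_lt hq)
      · have hopen : IsOpen {q : ℝ × ℝ | (1 / 2 : ℝ) < q.2} := isOpen_lt continuous_const continuous_snd
        have hmem : p ∈ {q : ℝ × ℝ | (1 / 2 : ℝ) < q.2} := by
          show (1 / 2 : ℝ) < p.2; linarith
        have h1 : ContDiffAt ℝ ∞ (fun q : ℝ × ℝ => q + (((cp - cm : ℤ) : ℝ), (0 : ℝ))) p :=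
          contDiffAt_id.add contDiffAt_const
        refine h1.congr_of_eventuallyEq (Filter.eventually_of_mem (hopen.mem_nhds hmem) ?_)
        intro q hq
        rw [hGup q (le_of_lt hq)]
        ext <;> simp
  · -- equivariance
    intro u r
    by_cases h1 : r ≤ -(1 / 2 : ℝ)
    · rw [hGlow (u + 1, r) h1, hGlow (u, r) h1]; ext <;> simp
    by_cases h2 : (1 / 2 : ℝ) ≤ r
    · rw [hGup (u + 1, r) h2, hGup (u, r) h2]; ext <;> simp; ring
    · have hr : r ∈ Ioo (-1 : ℝ) 1 := ⟨by linarith [not_le.1 h1], by linarith [not_le.1 h2]⟩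
      rw [hGmid (u + 1, r) h1 h2, hGmid (u, r) h1 h2, heqv u r hr]
      ext <;> simp; ring
  · intro u r hr
    rw [hGstrip (u, r) hr]
    simpa using hG₁r u r hr
  · intro u r σ hr h1 h2
    rw [habove u r σ hr h1 h2, hGstrip (u, r) hr]
    have h := periodic_int_shift hper cm ((G₁ (u, r)).1 - cm) (G₁ (u, r)).2 σ
    simp only [Prod.fst_sub, Prod.snd_sub, sub_zero]
    rw [← h, sub_add_cancel]

end Summit.SmoothPoincare4.SmoothPoincare4.Theorems.AcyclicBisectionExists.ModpBraidOrbits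

end
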